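import Mathlib
import HarnessLib
import Summits.HubbardSuperconductivity.HubbardSuperconductivity.Theorems.KLProgrammeKLRegimeEngineScaleZeroTwoLegBareFrame
import Summits.HubbardSuperconductivity.HubbardSuperconductivity.Theorems.KLProgrammeKLRegimeSplitTwoLegMomentsFromGridAll
import Summits.HubbardSuperconductivity.HubbardSuperconductivity.Theorems.KLProgrammeKLRegimeSplitTwoLegScaleZeroSizesSep

/-!
# K3 gen-7F (K3-FLOW RULING F, KL STATUS l.2548), engine-flow child, stub (M) AT THE BARE FRAME `K₀ = 0`: the GLOBAL sup-jets of the
# interpolated scale-`0` self-energy, the field strength, and the ANGULAR JETS `k ≤ 4` of the local part `ν₀(0)` on the FREE Fermi curve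

Cell gate-hubbard-kl, seat p1b (g8).  Composition of `…EngineScaleZeroTwoLegBareFrame` (closed-form grid sums `B₀`, `Bₖ`, `Bᵗ` at `K = 0` modulo the
normalised `(1+diam)ᵏ`-weighted covariance sizes `a k`) with p1b's bridges (`…TwoLegMomentsFromGridAll`) and the curve chain rule ([tree]
`PerturbedFermiCurve.abs_iteratedDeriv_comp_fermiPointLp_le_struct`, frame sizes `A₃ = A₄ = 0` at the bare frame):
* `twoLeg_momentumSizes_zero_frameZero_of_grid_upto` — the bridge with weighted hypotheses only up to a cut-off order `kmax`;
* **`twoLeg_momentumSizes_frameZero`** — `‖D⁰ I_L[σ₀]‖ ≤ (128/3)·e⁹κ₀²·|U|` and `‖Dᵏ I_L[σ₀]‖ ≤ 2^{k+10}·e¹⁸κ₀⁴·(a k)·U²` (`1 ≤ k ≤ kmax`) — PURE `U²`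
  at every order `k ≥ 1`, `M`-, `β`-, `L`-uniform;
* **`abs_klFieldStrength_frameZero_sub_one_le`** — (E3d) at the bare frame: `|z₀(k⃗) − 1| ≤ 2^{10}·e¹⁸κ₀⁴·(a 1)·U²` on the whole torus;
* **`twoLeg_readJets_frameZero`** — `ν₀(0) = klLocalPart … 0 0` is `C⁴` and `|ν₀|, |ν₀′|, …, |ν₀⁗|` are within the structured combinations of the
  `m k` with the absolute free-curve sizes `klCurveD1`, `klCurveD2`, `klCurveD3 0`, `klCurveD4 0 0` — the content of p2's V17F slot
  `TwoLegReadJetsF … 0` modulo the package fit (slot text pending S1).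
Inputs left as hypotheses (the ONLY analytic residue of (M)-F's first conjunct at scale `0`): the sizes `a k`, `k ≤ 4`, of the BARE grid covariance
and the smallnesses `16e⁹κ₀²·klScaleZeroA0·|U| ≤ 1/4`, `16e⁹κ₀²·(a k)·|U| ≤ 1/2`.  Proofs only; no definitions.
References: BGM 2006 §3 (3.2)–(3.3) [cite: BenfattoGiulianiMastropietro2006].
-/

noncomputable section

namespace Summit.HubbardSuperconductivity.HubbardSuperconductivity.Theorems.EngineV8

set_option linter.dupNamespace false -- summit = problem name (single-conjunct summit), D-0017

open Real Finset Literature.MathematicalPhysics.QuantumLattice Literature.Probability.LatticeModels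
open Literature.Probability.LatticeModels.BattleFederbush GrassmannAlgebra
open Summit.HubbardSuperconductivity.HubbardSuperconductivity.Theorems.KLRegimeSplit
open Summit.HubbardSuperconductivity.HubbardSuperconductivity.Theorems.DispersionFlow
open Summit.HubbardSuperconductivity.HubbardSuperconductivity.Theorems.PerturbedFermiCurve
open Summit.HubbardSuperconductivity.HubbardSuperconductivity.Theorems.TwoLegFourier
open Summit.HubbardSuperconductivity.HubbardSuperconductivity.Theorems.KLProgrammeLegKernels

variable {L M : ℕ} [NeZero L] [NeZero M]

/-! ## §1 The bridge with weighted hypotheses up to a cut-off order -/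

/-- **Scale-0, bare-frame momentum sizes from the grid, orders `k ≤ kmax`** (the `…_of_grid` bridge of `…TwoLegMomentsFromGridAll` asks the weighted
sums at EVERY order; here only up to `kmax`). -/
theorem twoLeg_momentumSizes_zero_frameZero_of_grid_upto {β : ℝ} (hβ : β ≠ 0) (U μ : ℝ) (kmax : ℕ) {B : ℕ → ℝ}
    (hB0 : ∀ (σ : Fin 2) (p₀ : GridPoint L (2 * (2 * M))), ∑ p₁ : GridPoint L (2 * (2 * M)),
      ‖kernel ℂ
        (effAction ℂ ((hubbardGridSub L M β (2 * (2 * M))).transpose * hubbardCovAboveCT L M β μ 0 0 klE0 *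
            hubbardGridSub L M β (2 * (2 * M))) (hubbardGridInteraction L (2 * (2 * M)) β U))
        2 (fun i => ((![p₀, p₁] i, σ), i))‖ ≤ B 0)
    (hBk : ∀ k, 1 ≤ k → k ≤ kmax → ∀ (σ : Fin 2) (p₀ : GridPoint L (2 * (2 * M))), ∑ p₁ : GridPoint L (2 * (2 * M)),
      (if p₁.2 - p₀.2 = 0 then (0 : ℝ) else
        (1 + (((p₁.2 - p₀.2) 0).valMinAbs.natAbs : ℝ) + (((p₁.2 - p₀.2) 1).valMinAbs.natAbs : ℝ)) ^ k) *
        ‖kernel ℂ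
          (effAction ℂ ((hubbardGridSub L M β (2 * (2 * M))).transpose * hubbardCovAboveCT L M β μ 0 0 klE0 *
              hubbardGridSub L M β (2 * (2 * M))) (hubbardGridInteraction L (2 * (2 * M)) β U))
          2 (fun i => ((![p₀, p₁] i, σ), i))‖ ≤ B k) :
    ∀ k ≤ kmax, ∀ q : Momentum, ‖iteratedFDeriv ℝ k (evalM (symInterp L (klLocSelfEnergyRe L M β U μ 0 0))) q‖ ≤
        2 * (Fintype.card (GridPoint L (2 * (2 * M))) : ℝ) / (|β| * (L : ℝ) ^ 2) * B k := by
  intro k hk q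
  -- truncate the weight family above `kmax` by the (finite) sums themselves
  classical
  set B' : ℕ → ℝ := fun j => if j ≤ kmax then B j else
    Finset.univ.sup' Finset.univ_nonempty (fun σp : Fin 2 × GridPoint L (2 * (2 * M)) => ∑ p₁ : GridPoint L (2 * (2 * M)),
      (if p₁.2 - σp.2.2 = 0 then (0 : ℝ) else
        (1 + (((p₁.2 - σp.2.2) 0).valMinAbs.natAbs : ℝ) + (((p₁.2 - σp.2.2) 1).valMinAbs.natAbs : ℝ)) ^ j) *
        ‖kernel ℂ
          (effAction ℂ ((hubbardGridSub L M β (2 * (2 * M))).transpose * hubbardCovAboveCT L M β μ 0 0 klE0 *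
              hubbardGridSub L M β (2 * (2 * M))) (hubbardGridInteraction L (2 * (2 * M)) β U))
          2 (fun i => ((![σp.2, p₁] i, σp.1), i))‖) with hB'
  have hB'k : B' k = B k := by simp [hB', hk]
  rw [← hB'k]
  refine twoLeg_momentumSizes_zero_frameZero_of_grid (L := L) (M := M) hβ U μ (B := B') (fun σ p₀ => ?_) (fun j hj σ p₀ => ?_) k q
  · have : B' 0 = B 0 := by simp [hB']
    rw [this]; exact hB0 σ p₀
  · by_cases hjk : j ≤ kmax
    · have : B' j = B j := by simp [hB', hjk]
      rw [this]; exact hBk j hj hjk σ p₀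
    · have : B' j = Finset.univ.sup' Finset.univ_nonempty (fun σp : Fin 2 × GridPoint L (2 * (2 * M)) =>
          ∑ p₁ : GridPoint L (2 * (2 * M)),
          (if p₁.2 - σp.2.2 = 0 then (0 : ℝ) else
            (1 + (((p₁.2 - σp.2.2) 0).valMinAbs.natAbs : ℝ) + (((p₁.2 - σp.2.2) 1).valMinAbs.natAbs : ℝ)) ^ j) *
            ‖kernel ℂ
              (effAction ℂ ((hubbardGridSub L M β (2 * (2 * M))).transpose * hubbardCovAboveCT L M β μ 0 0 klE0 *
                  hubbardGridSub L M β (2 * (2 * M))) (hubbardGridInteraction L (2 * (2 * M)) β U))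
              2 (fun i => ((![σp.2, p₁] i, σp.1), i))‖) := by simp [hB', hjk]
      rw [this]
      exact Finset.le_sup' (f := fun σp : Fin 2 × GridPoint L (2 * (2 * M)) => ∑ p₁ : GridPoint L (2 * (2 * M)),
          (if p₁.2 - σp.2.2 = 0 then (0 : ℝ) else
            (1 + (((p₁.2 - σp.2.2) 0).valMinAbs.natAbs : ℝ) + (((p₁.2 - σp.2.2) 1).valMinAbs.natAbs : ℝ)) ^ j) *
            ‖kernel ℂ
              (effAction ℂ ((hubbardGridSub L M β (2 * (2 * M))).transpose * hubbardCovAboveCT L M β μ 0 0 klE0 *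
                  hubbardGridSub L M β (2 * (2 * M))) (hubbardGridInteraction L (2 * (2 * M)) β U))
              2 (fun i => ((![σp.2, p₁] i, σp.1), i))‖) (Finset.mem_univ (σ, p₀))

/-! ## §2 The global sup-jets of `I_L[σ₀]` and the field strength at the bare frame -/

section Regime

variable {R : RenConsts} {μ U β : ℝ}

/-- The grid normalisation: `2·|GridPoint L 4M|/(|β|L²)·(X·β/(4M)) = 2·X` (`β > 0`). -/
theorem gridNorm_mul_eq {β : ℝ} (hβ : 0 < β) (X : ℝ) :
    2 * (Fintype.card (GridPoint L (2 * (2 * M))) : ℝ) / (|β| * (L : ℝ) ^ 2) * (X * (β / ((2 * (2 * M) : ℕ) : ℝ))) = 2 * X := by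
  have hN : (0 : ℝ) < ((2 * (2 * M) : ℕ) : ℝ) := by have := NeZero.ne M; positivity
  have hL : (0 : ℝ) < (L : ℝ) := by have := NeZero.ne L; positivity
  have hcard : (Fintype.card (GridPoint L (2 * (2 * M))) : ℝ) = ((2 * (2 * M) : ℕ) : ℝ) * (L : ℝ) ^ 2 := by
    rw [Fintype.card_prod, Fintype.card_fin, Fintype.card_pi, Fin.prod_const, ZMod.card]
    push_cast; ring
  rw [hcard, abs_of_pos hβ]
  field_simp

/-- **THE GLOBAL SUP-JETS OF THE INTERPOLATED SCALE-0 SELF-ENERGY AT THE BARE FRAME.**  Under the engine's regime sizes (`μ ∈ klWindowC`, `0 < U`,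
`klBetaMin ≤ β`, `klEngL₃ β U ≤ L`, `klEngM₃ β U L ≤ M`), the plain smallness `16e⁹κ₀²·klScaleZeroA0·|U| ≤ 1/4`, and, for `1 ≤ k ≤ kmax`, the
normalised `(1+diam)ᵏ`-weighted row/column sizes `a k` of the bare scale-`0` grid covariance with `16e⁹κ₀²·(a k)·|U| ≤ 1/2`:
`‖D⁰ evalM (symInterp L (klLocSelfEnergyRe … 0 0))‖ ≤ (128/3)·e⁹·κ₀²·|U|` and `‖Dᵏ …‖ ≤ 2^{k+10}·e¹⁸·κ₀⁴·(a k)·U²` everywhere on `Momentum`. -/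
theorem twoLeg_momentumSizes_frameZero (hR : R.WF) (Nsc : ℕ) (hμ : μ ∈ klWindowC) (hU : 0 < U) (hβ : klBetaMin ≤ β)
    (hL : klEngL₃ β U ≤ L) (hM : klEngM₃ β U L ≤ M)
    (hsmall₀ : 16 * Real.exp 1 ^ 9 * Real.sqrt (2 * (7 + 1606732)) ^ 2 * klScaleZeroA0 * |U| ≤ 1 / 4)
    (kmax : ℕ) {a : ℕ → ℝ} (ha : ∀ k, 1 ≤ k → k ≤ kmax → 0 < a k)
    (hrow : ∀ k, 1 ≤ k → k ≤ kmax → ∀ X, ∑ Y, ‖((hubbardGridSub L M β (2 * (2 * M))).transpose * hubbardCovAboveCT L M β μ 0 0 klE0 *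
        hubbardGridSub L M β (2 * (2 * M))) X Y‖ *
        diamWeight (fun s => (1 + 1 * s) ^ k) (gridLabelDist L (2 * (2 * M)) β) {gridLegPos X, gridLegPos Y} ≤
          a k * ((2 * (2 * M) : ℕ) : ℝ) / β)
    (hcol : ∀ k, 1 ≤ k → k ≤ kmax → ∀ Y, ∑ X, ‖((hubbardGridSub L M β (2 * (2 * M))).transpose * hubbardCovAboveCT L M β μ 0 0 klE0 *
        hubbardGridSub L M β (2 * (2 * M))) X Y‖ *
        diamWeight (fun s => (1 + 1 * s) ^ k) (gridLabelDist L (2 * (2 * M)) β) {gridLegPos X, gridLegPos Y} ≤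
          a k * ((2 * (2 * M) : ℕ) : ℝ) / β)
    (hsmall : ∀ k, 1 ≤ k → k ≤ kmax → 16 * Real.exp 1 ^ 9 * Real.sqrt (2 * (7 + 1606732)) ^ 2 * a k * |U| ≤ 1 / 2) :
    (∀ q : Momentum, ‖iteratedFDeriv ℝ 0 (evalM (symInterp L (klLocSelfEnergyRe L M β U μ 0 0))) q‖ ≤
        128 / 3 * Real.exp 1 ^ 9 * Real.sqrt (2 * (7 + 1606732)) ^ 2 * |U|) ∧
      ∀ k, 1 ≤ k → k ≤ kmax → ∀ q : Momentum, ‖iteratedFDeriv ℝ k (evalM (symInterp L (klLocSelfEnergyRe L M β U μ 0 0))) q‖ ≤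
        (2 : ℝ) ^ (k + 10) * Real.exp 1 ^ 18 * Real.sqrt (2 * (7 + 1606732)) ^ 4 * a k * U ^ 2 := by
  have hβ0 : 0 < β := lt_of_lt_of_le (by norm_num [klBetaMin]) hβ
  set B : ℕ → ℝ := fun k => if k = 0 then 64 / 3 * Real.exp 1 ^ 9 * Real.sqrt (2 * (7 + 1606732)) ^ 2 * |U| * (β / ((2 * (2 * M) : ℕ) : ℝ))
    else (2 : ℝ) ^ (k + 9) * Real.exp 1 ^ 18 * Real.sqrt (2 * (7 + 1606732)) ^ 4 * a k * U ^ 2 * (β / ((2 * (2 * M) : ℕ) : ℝ)) with hB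
  have h := twoLeg_momentumSizes_zero_frameZero_of_grid_upto (L := L) (M := M) hβ0.ne' U μ kmax (B := B)
    (fun σ p₀ => by simpa only [hB, if_true] using twoLeg_plain_point_sum_frameZero_le (L := L) hR Nsc hμ hU hβ hL hM hsmall₀ σ p₀)
    (fun k hk hkm σ p₀ => by
      have hk0 : k ≠ 0 := by omega
      simpa only [hB, hk0, if_false] using
        twoLeg_offDiag_moment_pow_sum_frameZero_le (L := L) hR Nsc hμ hU hβ hL hM k (ha k hk hkm) (hrow k hk hkm) (hcol k hk hkm)
          (hsmall k hk hkm) σ p₀)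
  refine ⟨fun q => ?_, fun k hk hkm q => ?_⟩
  · refine (h 0 (Nat.zero_le _) q).trans (le_of_eq ?_)
    simp only [hB, if_true]
    rw [gridNorm_mul_eq (L := L) (M := M) hβ0]; ring
  · refine (h k hkm q).trans (le_of_eq ?_)
    have hk0 : k ≠ 0 := by omega
    simp only [hB, hk0, if_false]
    rw [gridNorm_mul_eq (L := L) (M := M) hβ0, pow_succ]; ring

/-- **(E3d) AT THE BARE FRAME**: under the regime sizes and the normalised `wt₁`-weighted (`1 + diam`, time included) row/column size `a₁` of the bare
scale-`0` grid covariance with `16e⁹κ₀²·a₁·|U| ≤ 1/2`: `|klFieldStrength … 0 0 k⃗ − 1| ≤ 2^{10}·e¹⁸·κ₀⁴·a₁·U²` at EVERY torus momentum (so on every shell). -/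
theorem abs_klFieldStrength_frameZero_sub_one_le (hR : R.WF) (Nsc : ℕ) (hμ : μ ∈ klWindowC) (hU : 0 < U) (hβ : klBetaMin ≤ β)
    (hL : klEngL₃ β U ≤ L) (hM : klEngM₃ β U L ≤ M) {a₁ : ℝ} (ha : 0 < a₁)
    (hrow : ∀ X, ∑ Y, ‖((hubbardGridSub L M β (2 * (2 * M))).transpose * hubbardCovAboveCT L M β μ 0 0 klE0 *
        hubbardGridSub L M β (2 * (2 * M))) X Y‖ * gridLabelWt L (2 * (2 * M)) β {gridLegPos X, gridLegPos Y} ≤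
          a₁ * ((2 * (2 * M) : ℕ) : ℝ) / β)
    (hcol : ∀ Y, ∑ X, ‖((hubbardGridSub L M β (2 * (2 * M))).transpose * hubbardCovAboveCT L M β μ 0 0 klE0 *
        hubbardGridSub L M β (2 * (2 * M))) X Y‖ * gridLabelWt L (2 * (2 * M)) β {gridLegPos X, gridLegPos Y} ≤
          a₁ * ((2 * (2 * M) : ℕ) : ℝ) / β)
    (hsmall : 16 * Real.exp 1 ^ 9 * Real.sqrt (2 * (7 + 1606732)) ^ 2 * a₁ * |U| ≤ 1 / 2) (k : TorusSite 2 L) :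
    |klFieldStrength L M β U μ 0 0 k - 1| ≤ (2 : ℝ) ^ 10 * Real.exp 1 ^ 18 * Real.sqrt (2 * (7 + 1606732)) ^ 4 * a₁ * U ^ 2 := by
  have hβ0 : 0 < β := lt_of_lt_of_le (by norm_num [klBetaMin]) hβ
  have hN : (0 : ℝ) < ((2 * (2 * M) : ℕ) : ℝ) := by have := NeZero.ne M; positivity
  have h := abs_klFieldStrength_zero_frameZero_sub_one_le_of_grid_time_moment (L := L) (M := M) hβ0 U μ k
    (fun σ p₀ => twoLeg_time_sum_frameZero_le (L := L) hR Nsc hμ hU hβ hL hM ha hrow hcol hsmall σ p₀)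
  refine h.trans (le_of_eq ?_)
  field_simp

/-! ## §3 The angular jets `k ≤ 4` of `ν₀(0)` on the free Fermi curve -/

/-- The bare frame's correction is the zero function: all its derivatives vanish. -/
theorem norm_iteratedFDeriv_frameShift_zero (j : ℕ) (p : Momentum) : ‖iteratedFDeriv ℝ j (frameShift (0 : TrigPolyC4v)) p‖ ≤ 0 := by
  have hz : frameShift (0 : TrigPolyC4v) = fun _ : Momentum => (0 : ℝ) := by funext q; simp [frameShift]
  rw [hz, iteratedFDeriv_fun_zero]
  simp

/-- **THE ANGULAR JETS `k ≤ 4` OF `ν₀(0)` AT THE BARE FRAME FROM THE GLOBAL SUP-JETS** (the (E3a-F) reading jets at scale `0`): for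
`F := evalM (symInterp L (klLocSelfEnergyRe … 0 0))` with `‖DᵏF‖ ≤ m k` on `Momentum` (`k ≤ 4`), in the regime (`c ≤ klCurveC3 R`, `U ≤ klCurveU0 R`,
`klBetaMin ≤ β ≤ e^{c/U²}`, `μ ∈ klWindowC`): `ν₀(0) = klLocalPart L M β U μ 0 0` is `C⁴`, `|ν₀(0)| ≤ m 0`, `|ν₀′| ≤ m 1·D1`, `|ν₀″| ≤ m 2·D1² + m 1·D2`,
`|ν₀‴| ≤ m 3·D1³ + 3·m 2·D1·D2 + m 1·D3`, `|ν₀⁗| ≤ m 4·D1⁴ + 6·m 3·D1²·D2 + 3·m 2·D2² + 4·m 2·D1·D3 + m 1·D4` with the ABSOLUTE free-curve sizes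
`D1 = klCurveD1`, `D2 = klCurveD2`, `D3 = klCurveD3 0`, `D4 = klCurveD4 0 0` (the bare frame's own jets `A₃ = A₄ = 0`). -/
theorem twoLeg_readJets_frameZero (hRG : ∀ j, 0 ≤ R.Gfr j) {c : ℝ} (hc : 0 < c) (hcle : c ≤ klCurveC3 R) (hU : 0 < U)
    (hUle : U ≤ klCurveU0 R) (hβ : klBetaMin ≤ β) (hβc : β ≤ Real.exp (c / U ^ 2)) (hμ : μ ∈ klWindowC)
    (hK0 : FrameOK R U (nScales β) μ 0) {m : ℕ → ℝ}
    (hm : ∀ k ≤ 4, ∀ q : Momentum, ‖iteratedFDeriv ℝ k (evalM (symInterp L (klLocSelfEnergyRe L M β U μ 0 0))) q‖ ≤ m k) :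
    ContDiff ℝ 4 (klLocalPart L M β U μ 0 0) ∧ ∀ θ : ℝ,
      |klLocalPart L M β U μ 0 0 θ| ≤ m 0 ∧
      |iteratedDeriv 1 (klLocalPart L M β U μ 0 0) θ| ≤ m 1 * klCurveD1 ∧
      |iteratedDeriv 2 (klLocalPart L M β U μ 0 0) θ| ≤ m 2 * klCurveD1 ^ 2 + m 1 * klCurveD2 ∧
      |iteratedDeriv 3 (klLocalPart L M β U μ 0 0) θ| ≤ m 3 * klCurveD1 ^ 3 + 3 * m 2 * klCurveD1 * klCurveD2 + m 1 * klCurveD3 0 ∧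
      |iteratedDeriv 4 (klLocalPart L M β U μ 0 0) θ| ≤
        m 4 * klCurveD1 ^ 4 + 6 * m 3 * klCurveD1 ^ 2 * klCurveD2 + 3 * m 2 * klCurveD2 ^ 2 + 4 * m 2 * klCurveD1 * klCurveD3 0 +
          m 1 * klCurveD4 0 0 := by
  set F : Momentum → ℝ := evalM (symInterp L (klLocSelfEnergyRe L M β U μ 0 0)) with hF
  have hFc : ContDiff ℝ 4 F := contDiff_evalM _
  have hνF : klLocalPart L M β U μ 0 0 = F ∘ fun θ : ℝ => (WithLp.toLp 2 (klFermiPoint μ 0 θ) : Momentum) := by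
    have h := klLocalPart_zero_sub_frame_eq_comp (L := L) (M := M) β U μ (0 : TrigPolyC4v)
    have hl : (fun θ => klLocalPart L M β U μ 0 0 θ - (0 : TrigPolyC4v).eval (klFermiPoint μ 0 θ)) = klLocalPart L M β U μ 0 0 := by
      funext θ; simp
    rw [hl] at h
    rw [h]
    congr 1
    funext p
    simp [hF, evalM_apply]
  have hγ := fermiPointLp_sizes_explicit hRG hc hcle hU hUle hβ hβc hμ hK0 (norm_iteratedFDeriv_frameShift_zero 3)
    (norm_iteratedFDeriv_frameShift_zero 4)
  refine ⟨?_, fun θ => ⟨?_, ?_⟩⟩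
  · rw [hνF]; exact hFc.comp (hγ 0).1
  · rw [hνF, Function.comp_apply, ← Real.norm_eq_abs, ← norm_iteratedFDeriv_zero (𝕜 := ℝ)]
    exact hm 0 (by norm_num) _
  · have hstruct := abs_iteratedDeriv_comp_fermiPointLp_le_struct hRG hc hcle hU hUle hβ hβc hμ hK0 (norm_iteratedFDeriv_frameShift_zero 3)
      (norm_iteratedFDeriv_frameShift_zero 4) hFc θ (m := m) (fun k _ hk4 => hm k hk4 _)
    rw [hνF]
    exact hstruct

end Regime

end Summit.HubbardSuperconductivity.HubbardSuperconductivity.Theorems.EngineV8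

end
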